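import Summits.QuantumFields.QCD.Theorems.NestedDissectionSeaRobustYangMillsStubDeploymentDressed
import Literature.MathematicalPhysics.QuantumFieldTheory.QuasiLocalGaugePerturbationDressedMixing

/-!
# Line `local-ac-open-certificate` for the crux `RobustYangMills` (stmt-QuantumFields-13897) —
# reshape r6: the TWO-SPECIES COARSE-CELL ENGINE replaces the dressed engine

Crux: `Summit.QuantumFields.QCD.Theses.NestedDissectionSea.RobustYangMills` (shared verbatim with
`HeavyThresholdYMBridge` / `AdaptiveBlockFermions`); checked skeleton
`Cruxes/RobustYangMills/Lines/local_ac_open_certificate.lean`.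

**Why r6 (continuation lead c7, 2026-08-16).** The registered open stub `stub_dressedEngine :
DressedGaugeEngine 4` (r5) still spoke of gauge fields, polymers, Haar measures and the dressing
`W`. Variant C (leads c4–c6) is now carried out to the point where NO GAUGE OBJECT IS LEFT in the
open statement: the Bernoulli decoupling of the far polymers (Literature
`QuasiLocalGaugePerturbationDecoupling*`: joint `(U, mark)` specification with site-dependent a
priori measures, F1 `map_uOf_jointMeasure`, F2 `jointSpec_marks_allActive_le`, hyper-Markov
`integral_jointSpec_eq_of_exterior`), the two-species vocabulary (`CoarseCellHyperDefects`: sites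
with TERRITORIES and ACTIVITY events, `hvol`, `NoCrossing`, `IsHyperMarkov`, `IsGoodFSHyper`,
`HyperPeierls`) and the kernel-checked REDUCTION
`QuasiLocalGaugePerturbation.dressed_covariance_decay_of_hyperEngine` (Literature
`…DressedMixing`: the joint system of a dressed gauge measure satisfies every hypothesis of the
engine, with thresholds `η₀(n), κ₀(n), p₀(n)` and FS threshold `ε + 2(e^{2η₀(4n+1)^d} − 1)`). Hence

* `stub_dressedEngine` ↦ `stub_hyperEngine : HyperDefectEngine 4` (OPEN, the promotable
  statement: the annealed Dobrushin–Shlosman / van den Berg–Maes engine of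
  `annealed_influence_markov_defects` GENERALISED from bad cells to bad cells + active hyperedges —
  pure coarse-cell probability, `G`-blind, no polymers, no Haar measure);
* `dressedGaugeEngine_of_hyper : HyperDefectEngine 4 → DressedGaugeEngine 4` (CLOSED here, one
  line over the Literature reduction).

With all territories singletons and all activity events empty, `HyperDefectEngine d` is (up to
the empty second species) the landed `annealed_influence_markov_defects`; the open content is the
second species in the induction (`CoarseCellMixingDefects*` re-run on the hypergraph: cluster =
bad cells ∪ active marks linked through territories; `c4-variantC.md`, `c6-promote.md`).
-/

set_option autoImplicit false

noncomputable section

namespace Summit.QuantumFields.QCD.Cruxes.RobustYangMills.LocalAcOpenCertificate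

open scoped BigOperators ENNReal
open MeasureTheory
open Literature.MathematicalPhysics.QuantumLattice Literature.MathematicalPhysics.QuantumFieldTheory
open Literature.Probability.LatticeModels (CoarseIdx cdist shellCount cellCount IsGoodFS
  UniformKernelPeierls Specification IsSpecification IsGibbsMeasure hvol IsHyperMarkov IsGoodFSHyper
  HyperPeierls MarkRarity)

/-- **The two-species coarse-cell engine, covariance form** (statement of the OPEN stub
`stub_hyperEngine`; `d`-dimensional coarse tori): for every window `n` there are a Peierls
threshold `q₀ > 0`, a territory entropy `λ ≥ 0`, a rate `κₑ > 0` and a constant `C ≥ 0` such that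
every specification `γ` on a configuration space `V → S` whose sites carry home cells, TERRITORIES
and ACTIVITY EVENTS (ordinary sites: singleton territory, empty activity), on a coarse torus with
`≥ 4n+3` cells per axis, which is hyper-Markov, satisfies the good-exterior finite-size condition
`(n, ε)` with `ε · shellCount d n ≤ 3/4`, the two-species kernel-uniform Peierls bound at levels
`(q ≤ q₀, r)`, the unconditional rarity of active marks and the Kotecký–Preiss smallness
`∑_{v : c ∈ terr v} r_v e^{λ |terr v|} ≤ q` of the second species, has, under each of its Gibbs
measures `ν`, covariances `|ν(fg) − ν(f) ν(g)| ≤ C B_f B_g e^{|Δf|} |Δg| e^{−κₑ D}` for bounded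
measurable observables `f, g` of the ordinary sites of `Δf`, `Δg` at coarse distance `≥ D`. With
singleton territories and empty activities this is the covariance form of
`annealed_influence_markov_defects` (van den Berg–Maes 1994 / Dobrushin–Shlosman 1985 with
Peierls-rare defects); the second species is the new content (Kotecký–Preiss 1986 weights per
hyperedge; Bertini–Cirillo–Olivieri 2005 for graded cluster expansions with sparse defects). Not a
textbook theorem in this form. -/
def HyperDefectEngine (d : ℕ) : Prop :=
  ∀ n : ℕ, ∃ q₀ lam κₑ C : ℝ, 0 < q₀ ∧ 0 ≤ lam ∧ 0 < κₑ ∧ 0 ≤ C ∧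
  ∀ {μ : Fin d → ℕ} {V S : Type} [MeasurableSpace S] [Fintype V] [DecidableEq V]
    (cell : V → CoarseIdx μ) (terr : V → Finset (CoarseIdx μ)) (act : V → Set S)
    (γ : Specification V S) (good : CoarseIdx μ → Set (V → S)) (ν : Measure (V → S))
    (ε q : ℝ) (r : V → ℝ),
    (∀ i, 4 * n + 3 ≤ μ i + 1) → IsSpecification γ → IsGibbsMeasure γ ν →
    (∀ v, act v = ∅ → terr v = {cell v}) → (∀ v, MeasurableSet (act v)) →
    IsHyperMarkov cell terr act γ →
    0 ≤ ε → ε * (shellCount d n : ℝ) ≤ 3 / 4 → IsGoodFSHyper cell terr act γ good n ε →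
    0 ≤ q → q ≤ q₀ → (∀ v, 0 ≤ r v) → HyperPeierls terr act γ good q r → MarkRarity act γ r →
    (∀ c : CoarseIdx μ, ∑ v ∈ Finset.univ.filter (fun v => c ∈ terr v),
        r v * Real.exp (lam * (terr v).card) ≤ q) →
    ∀ (f g : (V → S) → ℝ) (Δf Δg : Finset (CoarseIdx μ)) (Bf Bg : ℝ) (D : ℕ),
      Measurable f → Measurable g → (∀ σ, |f σ| ≤ Bf) → (∀ σ, |g σ| ≤ Bg) →
      DependsOn f {v | act v = ∅ ∧ cell v ∈ Δf} → DependsOn g {v | act v = ∅ ∧ cell v ∈ Δg} →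
      (∀ x ∈ Δf, ∀ y ∈ Δg, D ≤ cdist x y) →
        |∫ σ, f σ * g σ ∂ν - (∫ σ, f σ ∂ν) * ∫ σ, g σ ∂ν| ≤
          C * Bf * Bg * Real.exp (Δf.card) * Δg.card * Real.exp (-(κₑ * D))

/-- **stub_dressedOfHyper — reshape r6: the dressed engine from the two-species engine** (registered
reduction stub, CLOSED; `stub_dressedEngine` of r5 is now closed modulo `stub_hyperEngine`): the
Literature reduction `QuasiLocalGaugePerturbation.dressed_covariance_decay_of_hyperEngine` read at
`d = 4`. -/
theorem stub_dressedOfHyper : HyperDefectEngine 4 → DressedGaugeEngine 4 := fun h =>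
  QuasiLocalGaugePerturbation.dressed_covariance_decay_of_hyperEngine h

/-- The reduction under its descriptive name. -/
theorem dressedGaugeEngine_of_hyper (h : HyperDefectEngine 4) : DressedGaugeEngine 4 :=
  stub_dressedOfHyper h

end Summit.QuantumFields.QCD.Cruxes.RobustYangMills.LocalAcOpenCertificate

end
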